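import Summits.CriticalPhenomena.PercolationContinuityZ3.Theorems.PercGamblersRuinVerticalGamblersRuinStubMinimalSolution
import Summits.CriticalPhenomena.PercolationContinuityZ3.Theorems.PercGamblersRuinVerticalGamblersRuinStubBadSetMassOfMin
import Summits.CriticalPhenomena.PercolationContinuityZ3.Theorems.PercGamblersRuinSymmetricSlabCalibration

/-!
# `stub_coreOfVGR` of line `registered` (crux `VerticalGamblersRuin`, stmt-CriticalPhenomena-10642):
# the crux implies the line's open core — the plate decomposition is an EQUIVALENT reformulation

Route `PercGamblersRuin` of `PercolationContinuityZ3`, skeleton rev 6 (`Cruxes/VerticalGamblersRuin/Lines/birth.lean`).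
The line reduces the crux (VGR) to `stub_coreDelta`: "if `θ(p_c) > 0` there are `k ≥ 1`, `κ > 0`, `δ > 0`
such that for all large `n`, every voltage field `v` of `(-kn, (k+1)n)` and the minimal solution `u` of
the lower slab `(-kn, kn)` with ceiling datum `1_{v(ω,·) < κ ∧ · ↔ ∞}` have `∫_{0↔∞} u(ω,0) dP_{p_c} ≤
θ(p_c)/2 - δ`".  This file proves the CONVERSE `stub_coreOfVGR : VerticalGamblersRuin → core`, certifying
that the open core is EQUIVALENT to the crux.  Proof: with VGR's witnesses `a < b`, `c > 0`, `N₀` take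
`k := a`, `κ := min (1/2) (c/(2θ))`, `δ := c/2`, `N := max N₀ 1`; the minimal `(a,b)`-voltage (monotone
iteration with minimality against nonnegative SUPERharmonic supersolutions, `minimalVoltage_superMin`)
lies below `v`, so VGR gives `c ≤ ∫_{0↔∞} v`; with `w`, `ṽ` the minimal lower-slab solutions with data
`1`, `v` (landed `stub_minimalSolution`): `(1-κ) u ≤ w - ṽ` pointwise (minimality of `u`), `∫_{0↔∞} ṽ =
∫_{0↔∞} v` (a.s. uniqueness at `0`, `StubBadSetMassOfMin.ae_eq_at_zero`), `∫_{0↔∞} w = θ/2` (reflection,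
`setIntegral_symm_eq`); hence `∫ u ≤ θ/2 - c + κθ ≤ θ/2 - c/2`.
References: Lyons–Peres (2016) §2.1; Barsky–Grimmett–Newman (1991).
-/

noncomputable section

namespace Summit.CriticalPhenomena.PercolationContinuityZ3.Theorems.VerticalGamblersRuin

open MeasureTheory Filter Topology
open Literature.Probability.Percolation Literature.Probability.LatticeModels
open scoped Classical

namespace StubCoreOfVGR

/-! ### Minimality against superharmonic supersolutions -/

section Abstract

variable {V : Type*} {N : V → Finset V} {p q : V → Prop} [DecidablePred p] [DecidablePred q]
  {g : V → ℝ} {Φ : (V → ℝ) → V → ℝ}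

/-- A nonnegative superharmonic supersolution (`f ≥ 0`, `g ≤ f` on the first plate, `∑ (f y - f x) ≤ 0`
off the plates) is a super-fixed-point of the averaging operator: `Φ f ≤ f`. [folklore] -/
theorem step_le_of_superharmonic
    (hΦ : ∀ f x, Φ f x = if p x then g x else if q x then 0 else (∑ y ∈ N x, f y) / ((N x).card : ℝ))
    {f : V → ℝ} (hf0 : ∀ x, 0 ≤ f x) (hfp : ∀ x, p x → g x ≤ f x)
    (hfh : ∀ x, ¬ p x → ¬ q x → ∑ y ∈ N x, (f y - f x) ≤ 0) (x : V) : Φ f x ≤ f x := by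
  rw [hΦ]  -- adapted from Theorems/PercGamblersRuinVerticalGamblersRuinStubMinimalSolution.lean
  split_ifs with hpx hqx
  · exact hfp x hpx
  · exact hf0 x
  · have h := hfh x hpx hqx
    rw [Finset.sum_sub_distrib, Finset.sum_const, nsmul_eq_mul, sub_nonpos] at h
    rcases eq_or_ne ((N x).card : ℝ) 0 with hc | hc
    · rw [hc, div_zero]
      exact hf0 x
    · rw [div_le_iff₀ (lt_of_le_of_ne (Nat.cast_nonneg _) (Ne.symm hc)), mul_comm]
      exact h

/-- Every iterate `Φ^[k] (g · 1_{p})` lies below every nonnegative superharmonic supersolution. [folklore] -/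
theorem iterate_le_of_superharmonic
    (hΦ : ∀ f x, Φ f x = if p x then g x else if q x then 0 else (∑ y ∈ N x, f y) / ((N x).card : ℝ))
    {f : V → ℝ} (hf0 : ∀ x, 0 ≤ f x) (hfp : ∀ x, p x → g x ≤ f x)
    (hfh : ∀ x, ¬ p x → ¬ q x → ∑ y ∈ N x, (f y - f x) ≤ 0) (k : ℕ) (x : V) :
    (Φ^[k] fun z => if p z then g z else 0) x ≤ f x := by
  induction k generalizing x with
  | zero =>
    simp only [Function.iterate_zero, id_eq]
    split_ifs with hpx
    · exact hfp x hpx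
    · exact hf0 x
  | succ k ih =>
    rw [Function.iterate_succ_apply']
    exact (StubMinimalSolution.step_mono hΦ ih x).trans (step_le_of_superharmonic hΦ hf0 hfp hfh x)

/-- The limit `⨆ k, Φ^[k] (g · 1_{p})` lies below every nonnegative superharmonic supersolution. [folklore] -/
theorem iSup_iterate_le_of_superharmonic
    (hΦ : ∀ f x, Φ f x = if p x then g x else if q x then 0 else (∑ y ∈ N x, f y) / ((N x).card : ℝ))
    {f : V → ℝ} (hf0 : ∀ x, 0 ≤ f x) (hfp : ∀ x, p x → g x ≤ f x)
    (hfh : ∀ x, ¬ p x → ¬ q x → ∑ y ∈ N x, (f y - f x) ≤ 0) (x : V) :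
    (⨆ k, (Φ^[k] fun z => if p z then g z else 0) x) ≤ f x :=
  ciSup_le fun k => iterate_le_of_superharmonic hΦ hf0 hfp hfh k x

end Abstract

/-! ### The minimal slab voltage with superharmonic minimality -/

open StubMinimalSolution in
/-- **Minimal slab voltage, superharmonic minimality.**  For `A, T ∈ ℕ`, `T > 0`, there is a selection
`w : Ω → ℤ³ → ℝ` of voltages of the slab `(-A, T)` (values in `[0,1]`, `= 1` on `{x₀ ≥ T}`, `= 0` on
`{x₀ ≤ -A}`, harmonic for the open lattice edges in between), measurable at every site, with `w ω ≤ f`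
for every nonnegative `f` that is `≥ 1` on `{x₀ ≥ T}` and SUPERharmonic (`∑ (f y - f x) ≤ 0`) on the open
slab — the monotone limit of the averaging iteration. [cite: LyonsPeres2016, §2.1] -/
theorem minimalVoltage_superMin (A T : ℕ) (_hT : 0 < T) :
    ∃ w : BondConfig (Site 3) → Site 3 → ℝ,
      (∀ x, Measurable fun ω => w ω x) ∧
      (∀ ω, (∀ x, 0 ≤ w ω x ∧ w ω x ≤ 1) ∧
        (∀ x : Site 3, (T : ℤ) ≤ x 0 → w ω x = 1) ∧
        (∀ x : Site 3, x 0 ≤ -(A : ℤ) → w ω x = 0) ∧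
        ∀ x : Site 3, -(A : ℤ) < x 0 → x 0 < (T : ℤ) →
          ∑ y ∈ ((zdGraph 3).neighborFinset x).filter (fun y => s(x, y) ∈ ω), (w ω y - w ω x) = 0) ∧
      ∀ (ω : BondConfig (Site 3)) (f : Site 3 → ℝ), (∀ x, 0 ≤ f x) →
        (∀ x : Site 3, (T : ℤ) ≤ x 0 → 1 ≤ f x) →
        (∀ x : Site 3, -(A : ℤ) < x 0 → x 0 < (T : ℤ) →
          ∑ y ∈ ((zdGraph 3).neighborFinset x).filter (fun y => s(x, y) ∈ ω), (f y - f x) ≤ 0) →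
        ∀ x, w ω x ≤ f x := by
  -- adapted from the proof of `stub_minimalSolution` (datum `1`), minimality clause strengthened
  set Φ : BondConfig (Site 3) → (Site 3 → ℝ) → Site 3 → ℝ := fun ω f x =>
    if (T : ℤ) ≤ x 0 then (1 : ℝ) else if x 0 ≤ -(A : ℤ) then 0 else
      (∑ y ∈ ((zdGraph 3).neighborFinset x).filter (fun y => s(x, y) ∈ ω), f y) /
        ((((zdGraph 3).neighborFinset x).filter (fun y => s(x, y) ∈ ω)).card : ℝ)
  have hΦ : ∀ ω f x, Φ ω f x = if (T : ℤ) ≤ x 0 then (fun (_ : BondConfig (Site 3)) (_ : Site 3) =>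
      (1 : ℝ)) ω x else if x 0 ≤ -(A : ℤ) then 0 else
      (∑ y ∈ ((zdGraph 3).neighborFinset x).filter (fun y => s(x, y) ∈ ω), f y) /
        ((((zdGraph 3).neighborFinset x).filter (fun y => s(x, y) ∈ ω)).card : ℝ) :=
    fun ω f x => rfl
  have hg : ∀ (_ : BondConfig (Site 3)) (_ : Site 3), (0 : ℝ) ≤ 1 ∧ (1 : ℝ) ≤ 1 :=
    fun _ _ => ⟨zero_le_one, le_rfl⟩
  refine ⟨fun ω x => ⨆ k, ((Φ ω)^[k] fun z => if (T : ℤ) ≤ z 0 then (1 : ℝ) else 0) x, ?_, ?_, ?_⟩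
  · intro x
    exact Measurable.iSup fun k =>
      measurable_iterate (A : ℤ) (T : ℤ) (g := fun _ _ => (1 : ℝ)) (fun _ => measurable_const) hΦ k x
  · intro ω
    refine ⟨?_, ?_, ?_, ?_⟩
    · intro x
      exact iSup_iterate_mem_Icc (p := fun z : Site 3 => (T : ℤ) ≤ z 0)
        (q := fun z : Site 3 => z 0 ≤ -(A : ℤ)) (g := fun _ => (1 : ℝ)) (hΦ ω) (hg ω) x
    · intro x hx
      exact iSup_iterate_eq_datum (p := fun z : Site 3 => (T : ℤ) ≤ z 0)
        (q := fun z : Site 3 => z 0 ≤ -(A : ℤ)) (g := fun _ => (1 : ℝ)) (hΦ ω) hx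
    · intro x hx
      have hpx : ¬ (T : ℤ) ≤ x 0 := by omega
      exact iSup_iterate_eq_zero (p := fun z : Site 3 => (T : ℤ) ≤ z 0)
        (q := fun z : Site 3 => z 0 ≤ -(A : ℤ)) (g := fun _ => (1 : ℝ)) (hΦ ω) hpx hx
    · intro x hlo hhi
      have hpx : ¬ (T : ℤ) ≤ x 0 := not_le.mpr hhi
      have hqx : ¬ x 0 ≤ -(A : ℤ) := not_le.mpr hlo
      exact sum_sub_iSup_iterate_eq_zero (p := fun z : Site 3 => (T : ℤ) ≤ z 0)
        (q := fun z : Site 3 => z 0 ≤ -(A : ℤ)) (g := fun _ => (1 : ℝ)) (hΦ ω) (hg ω) hpx hqx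
  · intro ω f hf0 hfT hfh x
    refine iSup_iterate_le_of_superharmonic (p := fun z : Site 3 => (T : ℤ) ≤ z 0)
      (q := fun z : Site 3 => z 0 ≤ -(A : ℤ)) (g := fun _ => (1 : ℝ)) (hΦ ω) hf0 hfT ?_ x
    intro y hpy hqy
    exact hfh y (not_le.mp hqy) (not_le.mp hpy)

/-! ### The exit mass of the symmetric slab is exactly `θ/2` -/

open SymmetricSlab in
/-- **Symmetric slab: `∫_{0↔∞} w = θ(p_c)/2`.**  For `m ≥ 1` and a selection `w` of voltages of the
symmetric slab `(-m, m)` (datum `1`, measurable at `0`), `∫_{0 ↔ ∞} w(ω,0) dP_{p_c} = θ(p_c)/2`: on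
`A = {0 ↔ ∞} ∖ {0 ↔ ∞ inside the slab}` one has `w(ω,0) + w(Rω,0) = 1` (`R` the reflection
`x₀ ↦ -x₀`, `sum_reflect_eq_one`), `P_{p_c}` and `A` are `R`-invariant, and at `p_c` the subtracted
event is null (BGN), so `A = {0 ↔ ∞}` a.e.  (The landed `symmetricSlabCalibration_proof` exports only `≥`.) -/
theorem setIntegral_symm_eq (m : ℕ) (hm : 0 < m) (w : BondConfig (Site 3) → Site 3 → ℝ)
    (hmeas : Measurable fun ω => w ω 0)
    (hsol : ∀ ω, (∀ x, 0 ≤ w ω x ∧ w ω x ≤ 1) ∧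
      (∀ x : Site 3, (m : ℤ) ≤ x 0 → w ω x = 1) ∧
      (∀ x : Site 3, x 0 ≤ -(m : ℤ) → w ω x = 0) ∧
      ∀ x : Site 3, -(m : ℤ) < x 0 → x 0 < (m : ℤ) →
        ∑ y ∈ ((zdGraph 3).neighborFinset x).filter (fun y => s(x, y) ∈ ω), (w ω y - w ω x) = 0) :
    ∫ ω in percolatesAt (0 : Site 3), w ω 0 ∂(bondPercolation (zdGraph 3) (criticalProbI 3)) =
      theta (zdGraph 3) (0 : Site 3) (criticalProbI 3) / 2 := by
  -- adapted from the proof of `symmetricSlabCalibration_proof`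
  obtain ⟨r, hr, hr0, hadj, hmap⟩ : ∃ r : Site 3 ≃ Site 3, (∀ x : Site 3, (r x) 0 = -(x 0)) ∧
      r 0 = 0 ∧ (∀ x y, (zdGraph 3).Adj (r x) (r y) ↔ (zdGraph 3).Adj x y) ∧
      Measure.map (BondConfig.relabel (sym2Equiv r)) (bondPercolation (zdGraph 3) (criticalProbI 3)) =
        bondPercolation (zdGraph 3) (criticalProbI 3) :=
    ⟨Site.signedPerm (d := 3) (Equiv.refl (Fin 3)) (Function.update 1 0 (-1)), refl_apply_zero,
      Site.signedPerm_zero _ _, adj_refl_iff,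
      bondPercolation_map_relabel_iso
        (zdSignedPermIso (d := 3) (Equiv.refl (Fin 3)) (Function.update 1 0 (-1))) (criticalProbI 3)⟩
  have hrS : ∀ x : Site 3, r x ∈ {z : Site 3 | -(m : ℤ) < z 0 ∧ z 0 < (m : ℤ)} ↔
      x ∈ {z : Site 3 | -(m : ℤ) < z 0 ∧ z 0 < (m : ℤ)} := fun x => by
    simp only [Set.mem_setOf_eq, hr]
    constructor <;> rintro ⟨h1, h2⟩ <;> exact ⟨by omega, by omega⟩
  have hBm : MeasurableSet (percolatesVia (withinGraph (zdGraph 3)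
      {z : Site 3 | -(m : ℤ) < z 0 ∧ z 0 < (m : ℤ)}) (0 : Site 3)) :=
    measurableSet_percolatesVia _ 0
  have hBsub : percolatesVia (withinGraph (zdGraph 3)
      {z : Site 3 | -(m : ℤ) < z 0 ∧ z 0 < (m : ℤ)}) (0 : Site 3) ⊆ percolatesAt 0 :=
    percolatesVia_subset_percolatesAt _ 0
  have hinv := refl_preimage_event r hr0 hrS hadj
  set B := percolatesVia (withinGraph (zdGraph 3)
      {z : Site 3 | -(m : ℤ) < z 0 ∧ z 0 < (m : ℤ)}) (0 : Site 3) with hBdef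
  set A := percolatesAt (0 : Site 3) \ B with hAdef
  set P := bondPercolation (zdGraph 3) (criticalProbI 3) with hPdef
  have hAm : MeasurableSet A := (measurableSet_percolatesAt_holds 0).diff hBm
  have hB0 : P B = 0 :=
    (measureReal_eq_zero_iff (by finiteness)).1 (StubBadSetMassOfMin.slab_percolatesVia_null m hm)
  have hθ : theta (zdGraph 3) 0 (criticalProbI 3) = P.real A := by
    rw [hAdef, measureReal_sdiff hBsub hBm, theta, ← hPdef, measureReal_def P B, hB0,
      ENNReal.toReal_zero, sub_zero]
  have hmp : MeasurePreserving (BondConfig.relabel (sym2Equiv r)) P P :=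
    ⟨(BondConfig.relabel (sym2Equiv r)).measurable, hmap⟩
  have hint : Integrable (fun ω => w ω 0) P :=
    Integrable.of_bound hmeas.aestronglyMeasurable 1 (Eventually.of_forall fun ω => by
      rw [Real.norm_eq_abs, abs_of_nonneg ((hsol ω).1 0).1]
      exact ((hsol ω).1 0).2)
  have hmeasR : Measurable (fun ω => w (BondConfig.relabel (sym2Equiv r) ω) 0) :=
    hmeas.comp (BondConfig.relabel (sym2Equiv r)).measurable
  have hintR : Integrable (fun ω => w (BondConfig.relabel (sym2Equiv r) ω) 0) P :=
    Integrable.of_bound hmeasR.aestronglyMeasurable 1 (Eventually.of_forall fun ω => by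
      rw [Real.norm_eq_abs, abs_of_nonneg ((hsol _).1 0).1]
      exact ((hsol _).1 0).2)
  have hswap : ∫ ω in A, w (BondConfig.relabel (sym2Equiv r) ω) 0 ∂P = ∫ ω in A, w ω 0 ∂P := by
    have h := hmp.setIntegral_preimage_emb (BondConfig.relabel (sym2Equiv r)).measurableEmbedding
      (fun ω => w ω 0) A
    rw [hinv] at h
    exact h
  have hae : ∀ᵐ ω ∂(P.restrict A), w ω 0 + w (BondConfig.relabel (sym2Equiv r) ω) 0 = (1 : ℝ) := by
    have h1 : ∀ᵐ ω ∂(P.restrict A), ω ⊆ (zdGraph 3).edgeSet :=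
      ae_restrict_of_ae ProbabilityTheory.setBernoulli_ae_subset
    have h2 : ∀ᵐ ω ∂(P.restrict A), ω ∈ A := ae_restrict_mem hAm
    filter_upwards [h1, h2] with ω hωE hωA
    exact sum_reflect_eq_one hm r hr hr0 hadj (fun ω x hx => (hsol ω).2.1 x hx)
      (fun ω x hx => (hsol ω).2.2.1 x hx) (fun ω x h1 h2 => (hsol ω).2.2.2 x h1 h2) hωE hωA.1 hωA.2
  have hsum : ∫ ω in A, (w ω 0 + w (BondConfig.relabel (sym2Equiv r) ω) 0) ∂P = P.real A := by
    rw [integral_congr_ae hae, setIntegral_const, smul_eq_mul, mul_one]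
  have hadd : ∫ ω in A, (w ω 0 + w (BondConfig.relabel (sym2Equiv r) ω) 0) ∂P =
      ∫ ω in A, w ω 0 ∂P + ∫ ω in A, w (BondConfig.relabel (sym2Equiv r) ω) 0 ∂P :=
    integral_add hint.integrableOn hintR.integrableOn
  have hhalf : ∫ ω in A, w ω 0 ∂P = P.real A / 2 := by linarith
  have hAae : (A : Set (BondConfig (Site 3))) =ᵐ[P] (percolatesAt (0 : Site 3) : Set (BondConfig (Site 3))) := by
    rw [hAdef]
    exact sdiff_null_ae_eq_self hB0
  calc ∫ ω in percolatesAt (0 : Site 3), w ω 0 ∂P = ∫ ω in A, w ω 0 ∂P :=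
        (setIntegral_congr_set hAae).symm
    _ = P.real A / 2 := hhalf
    _ = theta (zdGraph 3) 0 (criticalProbI 3) / 2 := by rw [hθ]

end StubCoreOfVGR

open StubCoreOfVGR in
/-- **stub `stub_coreOfVGR` of line `registered` (crux `VerticalGamblersRuin`, stmt-CriticalPhenomena-10642;
lead reshape rev 6): the crux implies the line's open core.**  If `VerticalGamblersRuin` holds (witnesses
`a < b`, `c > 0`, `N₀`) and `θ(p_c) > 0`, then with `k := a`, `κ := min (1/2) (c/(2θ))`, `δ := c/2`,
`N := max N₀ 1`: for all `n ≥ N`, every voltage field `v` of `(-kn, (k+1)n)` (measurable at every site)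
and the minimal lower-slab solution `u` with ceiling datum `1_{v(ω,·) < κ ∧ · ↔ ∞}` (measurable at every
site, minimal among nonnegative supersolutions) satisfy `∫_{0↔∞} u(ω,0) dP_{p_c} ≤ θ(p_c)/2 - δ`.  Together
with the skeleton's composition `VerticalGamblersRuin_of : core → VerticalGamblersRuin` this certifies
that the open core of the plate-decomposition line is EQUIVALENT to the crux. -/
theorem stub_coreOfVGR :
    Summit.CriticalPhenomena.PercolationContinuityZ3.Theses.PercGamblersRuin.VerticalGamblersRuin →
    0 < theta (zdGraph 3) (0 : Site 3) (criticalProbI 3) →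
    ∃ k : ℕ, 0 < k ∧ ∃ κ : ℝ, 0 < κ ∧ ∃ δ : ℝ, 0 < δ ∧ ∃ N : ℕ, ∀ n ≥ N,
      ∀ v : BondConfig (Site 3) → Site 3 → ℝ, (∀ x, Measurable fun ω => v ω x) →
        (∀ ω, (∀ x, 0 ≤ v ω x ∧ v ω x ≤ 1) ∧
          (∀ x : Site 3, (((k + 1) * n : ℕ) : ℤ) ≤ x 0 → v ω x = 1) ∧
          (∀ x : Site 3, x 0 ≤ -((k * n : ℕ) : ℤ) → v ω x = 0) ∧
          ∀ x : Site 3, -((k * n : ℕ) : ℤ) < x 0 → x 0 < (((k + 1) * n : ℕ) : ℤ) →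
            ∑ y ∈ ((zdGraph 3).neighborFinset x).filter (fun y => s(x, y) ∈ ω), (v ω y - v ω x) = 0) →
        ∀ u : BondConfig (Site 3) → Site 3 → ℝ, (∀ x, Measurable fun ω => u ω x) →
          (∀ ω, (∀ x, 0 ≤ u ω x ∧ u ω x ≤ 1) ∧
            (∀ x : Site 3, ((k * n : ℕ) : ℤ) ≤ x 0 →
              u ω x = if v ω x < κ ∧ ω ∈ percolatesAt x then 1 else 0) ∧
            (∀ x : Site 3, x 0 ≤ -((k * n : ℕ) : ℤ) → u ω x = 0) ∧
            ∀ x : Site 3, -((k * n : ℕ) : ℤ) < x 0 → x 0 < ((k * n : ℕ) : ℤ) →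
              ∑ y ∈ ((zdGraph 3).neighborFinset x).filter (fun y => s(x, y) ∈ ω), (u ω y - u ω x) = 0) →
          (∀ (ω : BondConfig (Site 3)) (f : Site 3 → ℝ), (∀ x, 0 ≤ f x) →
            (∀ x : Site 3, ((k * n : ℕ) : ℤ) ≤ x 0 →
              (if v ω x < κ ∧ ω ∈ percolatesAt x then (1 : ℝ) else 0) ≤ f x) →
            (∀ x : Site 3, -((k * n : ℕ) : ℤ) < x 0 → x 0 < ((k * n : ℕ) : ℤ) →
              ∑ y ∈ ((zdGraph 3).neighborFinset x).filter (fun y => s(x, y) ∈ ω), (f y - f x) = 0) →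
            ∀ x, u ω x ≤ f x) →
          ∫ ω in percolatesAt (0 : Site 3), u ω 0 ∂(bondPercolation (zdGraph 3) (criticalProbI 3)) ≤
            theta (zdGraph 3) (0 : Site 3) (criticalProbI 3) / 2 - δ := by
  intro hVGR hθ
  obtain ⟨a, b, ha, hab, c, hc, N₀, hV⟩ := hVGR hθ
  -- constants
  have hθ2 : 0 < 2 * theta (zdGraph 3) (0 : Site 3) (criticalProbI 3) := by linarith
  have hκpos : 0 < min (1 / 2 : ℝ) (c / (2 * theta (zdGraph 3) (0 : Site 3) (criticalProbI 3))) :=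
    lt_min (by norm_num) (div_pos hc hθ2)
  refine ⟨a, ha, min (1 / 2 : ℝ) (c / (2 * theta (zdGraph 3) (0 : Site 3) (criticalProbI 3))), hκpos,
    c / 2, by linarith, max N₀ 1, ?_⟩
  set θv : ℝ := theta (zdGraph 3) (0 : Site 3) (criticalProbI 3) with hθv
  set κ : ℝ := min (1 / 2 : ℝ) (c / (2 * θv)) with hκdef
  have hκhalf : κ ≤ 1 / 2 := min_le_left _ _
  have hκc : κ * θv ≤ c / 2 := by
    have h1 : κ ≤ c / (2 * θv) := min_le_right _ _
    calc κ * θv ≤ c / (2 * θv) * θv := mul_le_mul_of_nonneg_right h1 (le_of_lt hθ)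
      _ = c / 2 := by field_simp
  have h1κ : 0 < 1 - κ := by linarith
  intro n hn v hvmeas hvsol u humeas husol humin
  have hN₀ : N₀ ≤ n := le_trans (le_max_left _ _) hn
  have hn0 : 0 < n := le_trans (le_max_right _ _) hn
  have han : 0 < a * n := Nat.mul_pos ha hn0
  have hbn : 0 < b * n := Nat.mul_pos (lt_trans ha hab) hn0
  have hab' : (((a + 1) * n : ℕ) : ℤ) ≤ ((b * n : ℕ) : ℤ) := by
    exact_mod_cast Nat.mul_le_mul_right n hab
  set P := bondPercolation (zdGraph 3) (criticalProbI 3) with hPdef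
  -- Step 1: the minimal `(a,b)`-voltage lies below `v`, and VGR bounds its exit mass from below
  obtain ⟨vab, hvab_meas, hvab_sol, hvab_min⟩ := minimalVoltage_superMin (a * n) (b * n) hbn
  have hvab_le : ∀ ω x, vab ω x ≤ v ω x := by
    intro ω x
    refine hvab_min ω (v ω) (fun y => ((hvsol ω).1 y).1) (fun y hy => ?_) (fun y hlo hhi => ?_) x
    · rw [(hvsol ω).2.1 y (le_trans hab' hy)]
    · by_cases hlt : y 0 < (((a + 1) * n : ℕ) : ℤ)
      · exact le_of_eq ((hvsol ω).2.2.2 y hlo hlt)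
      · have hy1 : v ω y = 1 := (hvsol ω).2.1 y (not_lt.1 hlt)
        refine Finset.sum_nonpos (fun z _ => ?_)
        rw [hy1]
        linarith [((hvsol ω).1 z).2]
  have hc_le : c ≤ ∫ ω in percolatesAt (0 : Site 3), vab ω 0 ∂P :=
    hV n hN₀ vab (hvab_meas 0) (fun ω x => (hvab_sol ω).1 x) (fun ω x hx => (hvab_sol ω).2.1 x hx)
      (fun ω x hx => (hvab_sol ω).2.2.1 x hx) (fun ω x h1 h2 => (hvab_sol ω).2.2.2 x h1 h2)
  -- Step 2: the minimal lower-slab solutions with data `1` and `v`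
  obtain ⟨w, hw_meas, hw_sol, hw_min⟩ :=
    stub_minimalSolution (a * n) (a * n) han (fun _ _ => (1 : ℝ)) (fun _ => measurable_const)
      (fun _ _ => ⟨zero_le_one, le_rfl⟩)
  obtain ⟨vt, hvt_meas, hvt_sol, hvt_min⟩ :=
    stub_minimalSolution (a * n) (a * n) han (fun ω x => v ω x) hvmeas (fun ω x => (hvsol ω).1 x)
  -- Step 3: pointwise comparisons `vt ≤ w` and `(1 - κ) u ≤ w - vt`
  have hvt_le_w : ∀ ω x, vt ω x ≤ w ω x := fun ω x =>
    hvt_min ω (w ω) (fun y => ((hw_sol ω).1 y).1)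
      (fun y hy => by rw [(hw_sol ω).2.1 y hy]; exact ((hvsol ω).1 y).2)
      (fun y h1 h2 => (hw_sol ω).2.2.2 y h1 h2) x
  have hu_le : ∀ ω x, (1 - κ) * u ω x ≤ w ω x - vt ω x := by
    intro ω x
    have key : u ω x ≤ (w ω x - vt ω x) / (1 - κ) := by
      refine humin ω (fun y => (w ω y - vt ω y) / (1 - κ))
        (fun y => div_nonneg (sub_nonneg.2 (hvt_le_w ω y)) h1κ.le) (fun y hy => ?_) (fun y h1 h2 => ?_) x
      · -- datum: `1_{bad} ≤ (1 - v)/(1 - κ)` on the ceiling region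
        have hw1 : w ω y = 1 := (hw_sol ω).2.1 y hy
        have hvt1 : vt ω y = v ω y := (hvt_sol ω).2.1 y hy
        rw [hw1, hvt1]
        split_ifs with hbad
        · rw [le_div_iff₀ h1κ, one_mul]
          linarith [hbad.1]
        · exact div_nonneg (by linarith [((hvsol ω).1 y).2]) h1κ.le
      · -- harmonic on the open lower slab
        have e1 := (hw_sol ω).2.2.2 y h1 h2
        have e2 := (hvt_sol ω).2.2.2 y h1 h2
        calc ∑ z ∈ ((zdGraph 3).neighborFinset y).filter (fun z => s(y, z) ∈ ω),
              ((w ω z - vt ω z) / (1 - κ) - (w ω y - vt ω y) / (1 - κ))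
            = (∑ z ∈ ((zdGraph 3).neighborFinset y).filter (fun z => s(y, z) ∈ ω),
                ((w ω z - w ω y) - (vt ω z - vt ω y))) / (1 - κ) := by
              rw [Finset.sum_div]
              exact Finset.sum_congr rfl (fun z _ => by ring)
          _ = 0 := by rw [Finset.sum_sub_distrib, e1, e2, sub_zero, zero_div]
    have := (le_div_iff₀ h1κ).1 key
    linarith
  -- Step 4: integrability of the bounded integrands
  have hint : ∀ f : BondConfig (Site 3) → Site 3 → ℝ, Measurable (fun ω => f ω 0) →
      (∀ ω x, 0 ≤ f ω x ∧ f ω x ≤ 1) → Integrable (fun ω => f ω 0) P := by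
    intro f hf hb
    exact Integrable.of_bound hf.aestronglyMeasurable 1 (Eventually.of_forall fun ω => by
      rw [Real.norm_eq_abs, abs_of_nonneg (hb ω 0).1]
      exact (hb ω 0).2)
  have hv_int := hint v (hvmeas 0) (fun ω x => (hvsol ω).1 x)
  have hvab_int := hint vab (hvab_meas 0) (fun ω x => (hvab_sol ω).1 x)
  have hu_int := hint u (humeas 0) (fun ω x => (husol ω).1 x)
  have hw_int := hint w (hw_meas 0) (fun ω x => (hw_sol ω).1 x)
  have hvt_int := hint vt (hvt_meas 0) (fun ω x => (hvt_sol ω).1 x)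
  have hS : MeasurableSet (percolatesAt (0 : Site 3) : Set (BondConfig (Site 3))) :=
    measurableSet_percolatesAt_holds 0
  -- Step 5: the integral (in)equalities
  -- (i) `∫ vab ≤ ∫ v`
  have i1 : ∫ ω in percolatesAt (0 : Site 3), vab ω 0 ∂P ≤ ∫ ω in percolatesAt (0 : Site 3), v ω 0 ∂P :=
    setIntegral_mono hvab_int.integrableOn hv_int.integrableOn (fun ω => hvab_le ω 0)
  -- (ii) `∫ vt = ∫ v` (a.s. uniqueness at `0` on `{0 ↔ ∞}`)
  have i2 : ∫ ω in percolatesAt (0 : Site 3), vt ω 0 ∂P = ∫ ω in percolatesAt (0 : Site 3), v ω 0 ∂P := by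
    refine setIntegral_congr_ae hS ?_
    refine StubBadSetMassOfMin.ae_eq_at_zero (a * n) han (fun ω y hy => ?_)
      (fun ω y h1 h2 => (hvt_sol ω).2.2.2 y h1 h2) (fun ω y h1 h2 => ?_)
    · rcases not_and_or.1 hy with hy | hy
      · have hy' : y 0 ≤ -((a * n : ℕ) : ℤ) := not_lt.1 hy
        rw [(hvt_sol ω).2.2.1 y hy', (hvsol ω).2.2.1 y hy']
      · have hy' : ((a * n : ℕ) : ℤ) ≤ y 0 := not_lt.1 hy
        rw [(hvt_sol ω).2.1 y hy']
    · have h2' : y 0 < (((a + 1) * n : ℕ) : ℤ) := by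
        refine lt_of_lt_of_le h2 ?_
        exact_mod_cast Nat.mul_le_mul_right n (Nat.le_succ a)
      exact (hvsol ω).2.2.2 y h1 h2'
  -- (iii) `∫ w = θ/2`
  have i3 : ∫ ω in percolatesAt (0 : Site 3), w ω 0 ∂P = θv / 2 :=
    setIntegral_symm_eq (a * n) han w (hw_meas 0) hw_sol
  -- (iv) `(1 - κ) ∫ u ≤ ∫ w - ∫ vt`
  have i4 : (1 - κ) * ∫ ω in percolatesAt (0 : Site 3), u ω 0 ∂P ≤
      (∫ ω in percolatesAt (0 : Site 3), w ω 0 ∂P) - ∫ ω in percolatesAt (0 : Site 3), vt ω 0 ∂P := by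
    rw [← integral_const_mul, ← integral_sub hw_int.integrableOn hvt_int.integrableOn]
    exact setIntegral_mono (hu_int.const_mul (1 - κ)).integrableOn (hw_int.sub hvt_int).integrableOn
      (fun ω => hu_le ω 0)
  -- (v) `∫ u ≤ θ`
  have i5 : ∫ ω in percolatesAt (0 : Site 3), u ω 0 ∂P ≤ θv := by
    calc ∫ ω in percolatesAt (0 : Site 3), u ω 0 ∂P
        ≤ ∫ ω in percolatesAt (0 : Site 3), (1 : ℝ) ∂P :=
          setIntegral_mono hu_int.integrableOn (integrable_const (1 : ℝ)).integrableOn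
            (fun ω => ((husol ω).1 0).2)
      _ = θv := by rw [setIntegral_const, smul_eq_mul, mul_one, hθv, theta]
  -- (vi) conclusion
  have i6 : (1 - κ) * ∫ ω in percolatesAt (0 : Site 3), u ω 0 ∂P ≤ θv / 2 - c := by linarith
  have i7 : κ * ∫ ω in percolatesAt (0 : Site 3), u ω 0 ∂P ≤ κ * θv := mul_le_mul_of_nonneg_left i5 hκpos.le
  nlinarith [i6, i7, hκc]

end Summit.CriticalPhenomena.PercolationContinuityZ3.Theorems.VerticalGamblersRuin

end
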